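import Mathlib.GroupTheory.FreeGroup.Basic
import Mathlib.Algebra.Group.Subgroup.Basic
import Literature.GroupTheory.CombinatorialGroupTheory.NielsenMoves
import HarnessLib

/-!
# Basis changes in a free group relative to a set of generators

Topic `Literature/GroupTheory/CombinatorialGroupTheory`; theorems and (computable) automorphisms
only, no new mathematical notions.  Tools for changing a free basis of `F(ι)` by Nielsen moves
that touch ONE generator `x_k` and use words in the OTHER generators (`genAvoiding k`, the subgroup
generated by the `x_j`, `j ≠ k`):

* `replaceHom_eq_self_of_mem_genAvoiding` — the endomorphism `x_k ↦ w` of `NielsenMoves.lean`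
  fixes every word avoiding `x_k`;
* `mulGenAut k X Y` — the automorphism `x_k ↦ X · x_k · Y` (`X`, `Y` avoiding `x_k`), and
  `invGenMulAut k X Y` — the automorphism `x_k ↦ X · x_k⁻¹ · Y`;
* `conjGensAut S P` — conjugate the generators in `S` by a word `P` in the generators outside `S`;
* `sumCongrLeft β` — extend an isomorphism `F(J) ≃* F(E)` to `F(J ⊕ κ) ≃* F(E ⊕ κ)` by the
  identity on the fresh generators `κ` (adjoining fresh letters to a basis);
* `map_inl_mem_genAvoiding` — words coming from `F(J)` avoid the fresh generators;
* `optionNeEquiv e : (E ∖ {e}) ⊔ ⋆ ≃ E` and `adjoinEquiv e β'` — extend a basis of `F(E ∖ {e})` by the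
  letter `e`.

These are the moves used to build *geometric* free bases of ribbon-graph groups
(`RibbonGraphGeometricBasis.lean`).  Standard material: Lyndon–Schupp, *Combinatorial Group
Theory* (1977/2001), Ch. I §2 (Nielsen transformations) and Prop. 4.1.

## References
* R. C. Lyndon, P. E. Schupp, *Combinatorial Group Theory*, Springer (2001 reprint), Ch. I §2, §4.
  [LyndonSchupp2001]
-/

namespace Literature.GroupTheory.CombinatorialGroupTheory

universe u v w

variable {ι : Type u}

/-! ### Words avoiding a generator -/

/-- The subgroup of `F(ι)` generated by the basis elements indexed by `S`. [cite: LyndonSchupp2001, Ch. I §2 (Nielsen transformations) and Prop. 4.1] -/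
def genSubgroup (S : Set ι) : Subgroup (FreeGroup ι) :=
  Subgroup.closure (FreeGroup.of '' S)

/-- The subgroup of words avoiding the generator `x_k`: generated by the `x_j`, `j ≠ k`.
[cite: LyndonSchupp2001, Ch. I §2 (Nielsen transformations) and Prop. 4.1] -/
def genAvoiding (k : ι) : Subgroup (FreeGroup ι) := genSubgroup {j | j ≠ k}

/-- A generator indexed in `S` lies in `genSubgroup S`. [cite: LyndonSchupp2001, Ch. I §2 (Nielsen transformations) and Prop. 4.1] -/
theorem of_mem_genSubgroup {S : Set ι} {j : ι} (hj : j ∈ S) : FreeGroup.of j ∈ genSubgroup S :=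
  Subgroup.subset_closure ⟨j, hj, rfl⟩

/-- `x_j` avoids `x_k` for `j ≠ k`. [cite: LyndonSchupp2001, Ch. I §2 (Nielsen transformations) and Prop. 4.1] -/
theorem of_mem_genAvoiding {k j : ι} (hj : j ≠ k) : FreeGroup.of j ∈ genAvoiding k :=
  of_mem_genSubgroup hj

/-- `genSubgroup` is monotone. [cite: LyndonSchupp2001, Ch. I §2 (Nielsen transformations) and Prop. 4.1] -/
theorem genSubgroup_mono {S T : Set ι} (h : S ⊆ T) : genSubgroup S ≤ genSubgroup T :=
  Subgroup.closure_mono (Set.image_mono h)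

/-- Two homomorphisms out of `F(ι)` that agree on the generators indexed by `S` agree on
`genSubgroup S`. [cite: LyndonSchupp2001, Ch. I §2 (Nielsen transformations) and Prop. 4.1] -/
theorem eqOn_genSubgroup {G : Type v} [Group G] {f g : FreeGroup ι →* G} {S : Set ι}
    (h : ∀ j ∈ S, f (FreeGroup.of j) = g (FreeGroup.of j)) {x : FreeGroup ι} (hx : x ∈ genSubgroup S) :
    f x = g x := by
  refine MonoidHom.eqOn_closure (s := FreeGroup.of '' S) ?_ hx
  rintro _ ⟨j, hj, rfl⟩
  exact h j hj

/-- A homomorphism out of `F(ι)` fixing the generators indexed by `S` fixes `genSubgroup S`.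
[cite: LyndonSchupp2001, Ch. I §2 (Nielsen transformations) and Prop. 4.1] -/
theorem apply_eq_self_of_mem_genSubgroup {f : FreeGroup ι →* FreeGroup ι} {S : Set ι}
    (h : ∀ j ∈ S, f (FreeGroup.of j) = FreeGroup.of j) {x : FreeGroup ι} (hx : x ∈ genSubgroup S) :
    f x = x :=
  eqOn_genSubgroup (g := MonoidHom.id _) h hx

section Replace

variable [DecidableEq ι]

/-- The endomorphism `x_k ↦ w` fixes every word avoiding `x_k`. [cite: LyndonSchupp2001, Ch. I §2 (Nielsen transformations) and Prop. 4.1] -/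
theorem replaceHom_eq_self_of_mem_genAvoiding (k : ι) (w : FreeGroup ι) {x : FreeGroup ι}
    (hx : x ∈ genAvoiding k) : replaceHom k w x = x :=
  apply_eq_self_of_mem_genSubgroup (fun _ hj => replaceHom_of_ne hj w) hx

/-! ### `x_k ↦ X · x_k · Y` and `x_k ↦ X · x_k⁻¹ · Y` -/

/-- The Nielsen move `x_k ↦ X · x_k · Y` (all other generators fixed), for words `X`, `Y`
avoiding `x_k`; an automorphism with inverse `x_k ↦ X⁻¹ · x_k · Y⁻¹`.
[cite: LyndonSchupp2001, Ch. I §2] -/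
def mulGenAut (k : ι) (X Y : FreeGroup ι) (hX : X ∈ genAvoiding k) (hY : Y ∈ genAvoiding k) :
    MulAut (FreeGroup ι) :=
  replaceAut k (X * FreeGroup.of k * Y) (X⁻¹ * FreeGroup.of k * Y⁻¹)
    (by
      rw [_root_.map_mul, _root_.map_mul, replaceHom_of_self,
        replaceHom_eq_self_of_mem_genAvoiding k _ hX, replaceHom_eq_self_of_mem_genAvoiding k _ hY]
      group)
    (by
      rw [_root_.map_mul, _root_.map_mul, replaceHom_of_self, _root_.map_inv, _root_.map_inv,
        replaceHom_eq_self_of_mem_genAvoiding k _ hX, replaceHom_eq_self_of_mem_genAvoiding k _ hY]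
      group)

/-- `mulGenAut` on `x_k`. [cite: LyndonSchupp2001, Ch. I §2 (Nielsen transformations) and Prop. 4.1] -/
@[simp] theorem mulGenAut_of_self (k : ι) (X Y : FreeGroup ι) (hX hY) :
    mulGenAut k X Y hX hY (FreeGroup.of k) = X * FreeGroup.of k * Y :=
  replaceAut_of_self _ _ _ _ _

/-- `mulGenAut` fixes the other generators. [cite: LyndonSchupp2001, Ch. I §2 (Nielsen transformations) and Prop. 4.1] -/
@[simp] theorem mulGenAut_of_ne {k j : ι} (hj : j ≠ k) (X Y : FreeGroup ι) (hX hY) :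
    mulGenAut k X Y hX hY (FreeGroup.of j) = FreeGroup.of j :=
  replaceAut_of_ne hj _ _ _ _

/-- `mulGenAut` fixes words avoiding `x_k`. [cite: LyndonSchupp2001, Ch. I §2 (Nielsen transformations) and Prop. 4.1] -/
theorem mulGenAut_eq_self_of_mem {k : ι} (X Y : FreeGroup ι) (hX hY) {x : FreeGroup ι}
    (hx : x ∈ genAvoiding k) : mulGenAut k X Y hX hY x = x :=
  apply_eq_self_of_mem_genSubgroup (f := (mulGenAut k X Y hX hY).toMonoidHom)
    (fun _ hj => mulGenAut_of_ne hj X Y hX hY) hx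

/-- The Nielsen move `x_k ↦ X · x_k⁻¹ · Y` (all other generators fixed), for words `X`, `Y`
avoiding `x_k`; an automorphism with inverse `x_k ↦ Y · x_k⁻¹ · X`.
[cite: LyndonSchupp2001, Ch. I §2] -/
def invGenMulAut (k : ι) (X Y : FreeGroup ι) (hX : X ∈ genAvoiding k) (hY : Y ∈ genAvoiding k) :
    MulAut (FreeGroup ι) :=
  replaceAut k (X * (FreeGroup.of k)⁻¹ * Y) (Y * (FreeGroup.of k)⁻¹ * X)
    (by
      rw [_root_.map_mul, _root_.map_mul, _root_.map_inv, replaceHom_of_self,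
        replaceHom_eq_self_of_mem_genAvoiding k _ hX, replaceHom_eq_self_of_mem_genAvoiding k _ hY]
      group)
    (by
      rw [_root_.map_mul, _root_.map_mul, _root_.map_inv, replaceHom_of_self,
        replaceHom_eq_self_of_mem_genAvoiding k _ hX, replaceHom_eq_self_of_mem_genAvoiding k _ hY]
      group)

/-- `invGenMulAut` on `x_k`. [cite: LyndonSchupp2001, Ch. I §2 (Nielsen transformations) and Prop. 4.1] -/
@[simp] theorem invGenMulAut_of_self (k : ι) (X Y : FreeGroup ι) (hX hY) :
    invGenMulAut k X Y hX hY (FreeGroup.of k) = X * (FreeGroup.of k)⁻¹ * Y :=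
  replaceAut_of_self _ _ _ _ _

/-- `invGenMulAut` fixes the other generators. [cite: LyndonSchupp2001, Ch. I §2 (Nielsen transformations) and Prop. 4.1] -/
@[simp] theorem invGenMulAut_of_ne {k j : ι} (hj : j ≠ k) (X Y : FreeGroup ι) (hX hY) :
    invGenMulAut k X Y hX hY (FreeGroup.of j) = FreeGroup.of j :=
  replaceAut_of_ne hj _ _ _ _

/-- `invGenMulAut` fixes words avoiding `x_k`. [cite: LyndonSchupp2001, Ch. I §2 (Nielsen transformations) and Prop. 4.1] -/
theorem invGenMulAut_eq_self_of_mem {k : ι} (X Y : FreeGroup ι) (hX hY) {x : FreeGroup ι}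
    (hx : x ∈ genAvoiding k) : invGenMulAut k X Y hX hY x = x :=
  apply_eq_self_of_mem_genSubgroup (f := (invGenMulAut k X Y hX hY).toMonoidHom)
    (fun _ hj => invGenMulAut_of_ne hj X Y hX hY) hx

end Replace

/-! ### Conjugating a block of generators -/

/-- The endomorphism conjugating the generators indexed by `S` by `P` and fixing the others.
[cite: LyndonSchupp2001, Ch. I §2 (Nielsen transformations) and Prop. 4.1] -/
def conjGensHom (S : Set ι) [DecidablePred (· ∈ S)] (P : FreeGroup ι) : FreeGroup ι →* FreeGroup ι :=
  FreeGroup.lift fun j => if j ∈ S then P * FreeGroup.of j * P⁻¹ else FreeGroup.of j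

/-- `conjGensHom` on a generator in the block. [cite: LyndonSchupp2001, Ch. I §2 (Nielsen transformations) and Prop. 4.1] -/
@[simp] theorem conjGensHom_of_mem {S : Set ι} [DecidablePred (· ∈ S)] (P : FreeGroup ι) {j : ι}
    (hj : j ∈ S) : conjGensHom S P (FreeGroup.of j) = P * FreeGroup.of j * P⁻¹ := by
  simp [conjGensHom, hj]

/-- `conjGensHom` on a generator outside the block. [cite: LyndonSchupp2001, Ch. I §2 (Nielsen transformations) and Prop. 4.1] -/
@[simp] theorem conjGensHom_of_not_mem {S : Set ι} [DecidablePred (· ∈ S)] (P : FreeGroup ι) {j : ι}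
    (hj : j ∉ S) : conjGensHom S P (FreeGroup.of j) = FreeGroup.of j := by
  simp [conjGensHom, hj]

/-- `conjGensHom` fixes words in the generators outside the block. [cite: LyndonSchupp2001, Ch. I §2 (Nielsen transformations) and Prop. 4.1] -/
theorem conjGensHom_eq_self_of_mem {S : Set ι} [DecidablePred (· ∈ S)] (P : FreeGroup ι)
    {x : FreeGroup ι} (hx : x ∈ genSubgroup Sᶜ) : conjGensHom S P x = x :=
  apply_eq_self_of_mem_genSubgroup (fun _ hj => conjGensHom_of_not_mem P hj) hx

/-- Conjugating the block by `P` and then by `P⁻¹` is the identity, when `P` avoids the block.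
[cite: LyndonSchupp2001, Ch. I §2 (Nielsen transformations) and Prop. 4.1] -/
theorem conjGensHom_comp_inv (S : Set ι) [DecidablePred (· ∈ S)] {P : FreeGroup ι}
    (hP : P ∈ genSubgroup Sᶜ) : (conjGensHom S P⁻¹).comp (conjGensHom S P) = MonoidHom.id _ := by
  ext j
  by_cases hj : j ∈ S
  · rw [MonoidHom.coe_comp, Function.comp_apply, conjGensHom_of_mem P hj, _root_.map_mul,
      _root_.map_mul, _root_.map_inv, conjGensHom_of_mem P⁻¹ hj,
      conjGensHom_eq_self_of_mem P⁻¹ hP, MonoidHom.id_apply]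
    group
  · simp [hj]

/-- The Nielsen move conjugating the generators indexed by `S` by a word `P` in the OTHER
generators (an automorphism, inverse: conjugation of the block by `P⁻¹`).
[cite: LyndonSchupp2001, Ch. I §2] -/
def conjGensAut (S : Set ι) [DecidablePred (· ∈ S)] (P : FreeGroup ι) (hP : P ∈ genSubgroup Sᶜ) :
    MulAut (FreeGroup ι) :=
  (conjGensHom S P).toMulEquiv (conjGensHom S P⁻¹) (conjGensHom_comp_inv S hP)
    (by simpa using conjGensHom_comp_inv S (P := P⁻¹) (inv_mem hP))

/-- `conjGensAut` on a generator in the block. [cite: LyndonSchupp2001, Ch. I §2 (Nielsen transformations) and Prop. 4.1] -/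
@[simp] theorem conjGensAut_of_mem {S : Set ι} [DecidablePred (· ∈ S)] (P : FreeGroup ι) (hP)
    {j : ι} (hj : j ∈ S) : conjGensAut S P hP (FreeGroup.of j) = P * FreeGroup.of j * P⁻¹ :=
  conjGensHom_of_mem P hj

/-- `conjGensAut` on a generator outside the block. [cite: LyndonSchupp2001, Ch. I §2 (Nielsen transformations) and Prop. 4.1] -/
@[simp] theorem conjGensAut_of_not_mem {S : Set ι} [DecidablePred (· ∈ S)] (P : FreeGroup ι) (hP)
    {j : ι} (hj : j ∉ S) : conjGensAut S P hP (FreeGroup.of j) = FreeGroup.of j :=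
  conjGensHom_of_not_mem P hj

/-- `conjGensAut` fixes words in the generators outside the block. [cite: LyndonSchupp2001, Ch. I §2 (Nielsen transformations) and Prop. 4.1] -/
theorem conjGensAut_eq_self_of_mem {S : Set ι} [DecidablePred (· ∈ S)] (P : FreeGroup ι) (hP)
    {x : FreeGroup ι} (hx : x ∈ genSubgroup Sᶜ) : conjGensAut S P hP x = x :=
  conjGensHom_eq_self_of_mem P hx

/-- `conjGensAut` acts on words in the block generators by conjugation. [cite: LyndonSchupp2001, Ch. I §2 (Nielsen transformations) and Prop. 4.1] -/
theorem conjGensAut_eq_conj_of_mem {S : Set ι} [DecidablePred (· ∈ S)] (P : FreeGroup ι) (hP)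
    {x : FreeGroup ι} (hx : x ∈ genSubgroup S) : conjGensAut S P hP x = P * x * P⁻¹ := by
  refine eqOn_genSubgroup (f := (conjGensAut S P hP).toMonoidHom)
    (g := (MulAut.conj P).toMonoidHom) (fun j hj => ?_) hx
  simp [conjGensAut_of_mem P hP hj]

/-! ### Adjoining fresh generators -/

section Sum

variable {J : Type u} {E : Type v} {κ : Type w}

/-- The homomorphism `F(J ⊕ κ) → F(E ⊕ κ)` extending `β : F(J) →* F(E)` by the identity on the
fresh generators `κ`. [cite: LyndonSchupp2001, Ch. I §2 (Nielsen transformations) and Prop. 4.1] -/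
def sumExtendHom (β : FreeGroup J →* FreeGroup E) : FreeGroup (J ⊕ κ) →* FreeGroup (E ⊕ κ) :=
  FreeGroup.lift (Sum.elim (fun j => FreeGroup.map Sum.inl (β (FreeGroup.of j)))
    (fun c => FreeGroup.of (Sum.inr c)))

/-- `sumExtendHom` on an old generator. [cite: LyndonSchupp2001, Ch. I §2 (Nielsen transformations) and Prop. 4.1] -/
@[simp] theorem sumExtendHom_of_inl (β : FreeGroup J →* FreeGroup E) (j : J) :
    sumExtendHom (κ := κ) β (FreeGroup.of (Sum.inl j)) = FreeGroup.map Sum.inl (β (FreeGroup.of j)) := by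
  simp [sumExtendHom]

/-- `sumExtendHom` on a fresh generator. [cite: LyndonSchupp2001, Ch. I §2 (Nielsen transformations) and Prop. 4.1] -/
@[simp] theorem sumExtendHom_of_inr (β : FreeGroup J →* FreeGroup E) (c : κ) :
    sumExtendHom (κ := κ) β (FreeGroup.of (Sum.inr c)) = FreeGroup.of (Sum.inr c) := by
  simp [sumExtendHom]

/-- `sumExtendHom` restricted to the old letters is `β` followed by the inclusion. [cite: LyndonSchupp2001, Ch. I §2 (Nielsen transformations) and Prop. 4.1] -/
theorem sumExtendHom_map_inl (β : FreeGroup J →* FreeGroup E) (x : FreeGroup J) :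
    sumExtendHom (κ := κ) β (FreeGroup.map Sum.inl x) = FreeGroup.map Sum.inl (β x) := by
  have h : (sumExtendHom (κ := κ) β).comp (FreeGroup.map (Sum.inl : J → J ⊕ κ)) =
      (FreeGroup.map (Sum.inl : E → E ⊕ κ)).comp β := by
    ext j; simp
  exact DFunLike.congr_fun h x

/-- `sumExtendHom` is functorial in `β`. [cite: LyndonSchupp2001, Ch. I §2 (Nielsen transformations) and Prop. 4.1] -/
theorem sumExtendHom_comp {L : Type*} (β : FreeGroup J →* FreeGroup E) (γ : FreeGroup E →* FreeGroup L) :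
    (sumExtendHom (κ := κ) γ).comp (sumExtendHom β) = sumExtendHom (γ.comp β) := by
  ext x
  rcases x with j | c
  · rw [MonoidHom.coe_comp, Function.comp_apply, sumExtendHom_of_inl, sumExtendHom_map_inl,
      sumExtendHom_of_inl, MonoidHom.coe_comp, Function.comp_apply]
  · simp

/-- `sumExtendHom` of the identity is the identity. [cite: LyndonSchupp2001, Ch. I §2 (Nielsen transformations) and Prop. 4.1] -/
theorem sumExtendHom_id : sumExtendHom (κ := κ) (MonoidHom.id (FreeGroup J)) = MonoidHom.id _ := by
  ext x
  rcases x with j | c <;> simp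

/-- Adjoin fresh generators `κ` to an isomorphism `F(J) ≃* F(E)`: the isomorphism
`F(J ⊕ κ) ≃* F(E ⊕ κ)` that is `β` on the old letters and the identity on the new ones.
[cite: LyndonSchupp2001, Ch. I Prop 4.1] -/
def sumCongrLeft (β : FreeGroup J ≃* FreeGroup E) : FreeGroup (J ⊕ κ) ≃* FreeGroup (E ⊕ κ) :=
  (sumExtendHom β.toMonoidHom).toMulEquiv (sumExtendHom β.symm.toMonoidHom)
    (by rw [sumExtendHom_comp]; convert sumExtendHom_id (J := J) (κ := κ); ext; simp)
    (by rw [sumExtendHom_comp]; convert sumExtendHom_id (J := E) (κ := κ); ext; simp)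

/-- `sumCongrLeft` on an old generator. [cite: LyndonSchupp2001, Ch. I §2 (Nielsen transformations) and Prop. 4.1] -/
@[simp] theorem sumCongrLeft_of_inl (β : FreeGroup J ≃* FreeGroup E) (j : J) :
    sumCongrLeft (κ := κ) β (FreeGroup.of (Sum.inl j)) = FreeGroup.map Sum.inl (β (FreeGroup.of j)) :=
  sumExtendHom_of_inl (κ := κ) β.toMonoidHom j

/-- `sumCongrLeft` on a fresh generator. [cite: LyndonSchupp2001, Ch. I §2 (Nielsen transformations) and Prop. 4.1] -/
@[simp] theorem sumCongrLeft_of_inr (β : FreeGroup J ≃* FreeGroup E) (c : κ) :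
    sumCongrLeft (κ := κ) β (FreeGroup.of (Sum.inr c)) = FreeGroup.of (Sum.inr c) :=
  sumExtendHom_of_inr (κ := κ) β.toMonoidHom c

/-- `sumCongrLeft` on a word in the old letters. [cite: LyndonSchupp2001, Ch. I §2 (Nielsen transformations) and Prop. 4.1] -/
theorem sumCongrLeft_map_inl (β : FreeGroup J ≃* FreeGroup E) (x : FreeGroup J) :
    sumCongrLeft (κ := κ) β (FreeGroup.map Sum.inl x) = FreeGroup.map Sum.inl (β x) :=
  sumExtendHom_map_inl (κ := κ) β.toMonoidHom x

/-- Words in the old letters avoid every fresh generator. [cite: LyndonSchupp2001, Ch. I §2 (Nielsen transformations) and Prop. 4.1] -/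
theorem map_inl_mem_genAvoiding (x : FreeGroup E) (c : κ) :
    FreeGroup.map (Sum.inl : E → E ⊕ κ) x ∈ genAvoiding (Sum.inr c) := by
  refine FreeGroup.induction_on x (one_mem _) (fun e => ?_) (fun e he => ?_) fun a b ha hb => ?_
  · simpa using of_mem_genAvoiding (k := (Sum.inr c : E ⊕ κ)) (j := Sum.inl e) (by simp)
  · simpa using inv_mem he
  · simpa using mul_mem ha hb

/-- Words in the old letters lie in the subgroup generated by the old letters. [cite: LyndonSchupp2001, Ch. I §2 (Nielsen transformations) and Prop. 4.1] -/
theorem map_inl_mem_genSubgroup_range_inl (x : FreeGroup E) :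
    FreeGroup.map (Sum.inl : E → E ⊕ κ) x ∈ genSubgroup (Set.range (Sum.inl : E → E ⊕ κ)) := by
  refine FreeGroup.induction_on x (one_mem _) (fun e => ?_) (fun e he => ?_) fun a b ha hb => ?_
  · simpa using of_mem_genSubgroup (S := Set.range (Sum.inl : E → E ⊕ κ)) ⟨e, rfl⟩
  · simpa using inv_mem he
  · simpa using mul_mem ha hb

end Sum

/-! ### Adjoining a fresh edge letter -/

section Adjoin

variable {E : Type v} [DecidableEq E] (e : E)

/-- `(E ∖ {e}) ⊔ {⋆} ≃ E`. [cite: LyndonSchupp2001, Ch. I §2 (Nielsen transformations) and Prop. 4.1] -/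
def optionNeEquiv : ({x : E // x ≠ e} ⊕ Unit) ≃ E where
  toFun := Sum.elim Subtype.val fun _ => e
  invFun y := if h : y = e then Sum.inr () else Sum.inl ⟨y, h⟩
  left_inv := by
    rintro (⟨y, hy⟩ | ⟨⟩)
    · simp [hy]
    · simp
  right_inv y := by
    by_cases h : y = e
    · simp [h]
    · simp [h]

/-- `optionNeEquiv_inl`: bookkeeping lemma of this construction (see the module docstring). [cite: LyndonSchupp2001, Ch. I §2 (Nielsen transformations) and Prop. 4.1] -/
@[simp] theorem optionNeEquiv_inl (x : {x : E // x ≠ e}) : optionNeEquiv e (Sum.inl x) = x.1 := rfl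

/-- `optionNeEquiv_inr`: bookkeeping lemma of this construction (see the module docstring). [cite: LyndonSchupp2001, Ch. I §2 (Nielsen transformations) and Prop. 4.1] -/
@[simp] theorem optionNeEquiv_inr (u : Unit) : optionNeEquiv e (Sum.inr u) = e := rfl

variable {J : Type}

/-- Extend a free basis `β'` of `F(E ∖ {e})` to a free basis of `F(E)` by the fresh letter `e`.
[cite: LyndonSchupp2001, Ch. I §2 (Nielsen transformations) and Prop. 4.1] -/
def adjoinEquiv (β' : FreeGroup J ≃* FreeGroup {x : E // x ≠ e}) : FreeGroup (J ⊕ Unit) ≃* FreeGroup E :=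
  (sumCongrLeft β').trans (FreeGroup.freeGroupCongr (optionNeEquiv e))

/-- `adjoinEquiv_map_inl`: bookkeeping lemma of this construction (see the module docstring). [cite: LyndonSchupp2001, Ch. I §2 (Nielsen transformations) and Prop. 4.1] -/
theorem adjoinEquiv_map_inl (β' : FreeGroup J ≃* FreeGroup {x : E // x ≠ e}) (x : FreeGroup J) :
    adjoinEquiv e β' (FreeGroup.map Sum.inl x) = FreeGroup.map Subtype.val (β' x) := by
  rw [adjoinEquiv, MulEquiv.trans_apply, sumCongrLeft_map_inl, FreeGroup.freeGroupCongr_apply,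
    FreeGroup.map.comp]
  rfl

/-- `adjoinEquiv_of_inl`: bookkeeping lemma of this construction (see the module docstring). [cite: LyndonSchupp2001, Ch. I §2 (Nielsen transformations) and Prop. 4.1] -/
@[simp] theorem adjoinEquiv_of_inl (β' : FreeGroup J ≃* FreeGroup {x : E // x ≠ e}) (j : J) :
    adjoinEquiv e β' (FreeGroup.of (Sum.inl j)) = FreeGroup.map Subtype.val (β' (FreeGroup.of j)) := by
  rw [← FreeGroup.map.of, adjoinEquiv_map_inl]

/-- `adjoinEquiv_of_inr`: bookkeeping lemma of this construction (see the module docstring). [cite: LyndonSchupp2001, Ch. I §2 (Nielsen transformations) and Prop. 4.1] -/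
@[simp] theorem adjoinEquiv_of_inr (β' : FreeGroup J ≃* FreeGroup {x : E // x ≠ e}) (u : Unit) :
    adjoinEquiv e β' (FreeGroup.of (Sum.inr u)) = FreeGroup.of e := by
  rw [adjoinEquiv, MulEquiv.trans_apply, sumCongrLeft_of_inr, FreeGroup.freeGroupCongr_apply,
    FreeGroup.map.of]
  rfl

/-- A word in the old letters, pushed through an automorphism of `F((E ∖ {e}) ⊔ ⋆)` fixing words
that avoid the fresh letter, then to `F(E)`. [cite: LyndonSchupp2001, Ch. I §2 (Nielsen transformations) and Prop. 4.1] -/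
theorem freeGroupCongr_optionNeEquiv_map_inl_of_fix
    (θ : MulAut (FreeGroup ({x : E // x ≠ e} ⊕ Unit)))
    (hθ : ∀ y, y ∈ genAvoiding (Sum.inr ()) → θ y = y) (x : FreeGroup {x : E // x ≠ e}) :
    FreeGroup.freeGroupCongr (optionNeEquiv e) (θ (FreeGroup.map Sum.inl x)) =
      FreeGroup.map Subtype.val x := by
  rw [hθ _ (map_inl_mem_genAvoiding x ()), FreeGroup.freeGroupCongr_apply, FreeGroup.map.comp]
  rfl

end Adjoin


end Literature.GroupTheory.CombinatorialGroupTheory
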